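/-
Copyright (c) 2026 the pub-hodgecm-mathlib formalisation cell (harness21).  Prover seat hodgecm-mathlib-K2Liu-p05 (g3), 2026-09-04
(Track B «K2-LIT», crux hLiu418 = stmt-HodgeConjecture-24832, socket #42F′ `sig_K2LiuFirstTermIdentityOnGenerators`, ROAD I v3 («uniqueness road»,
RULING M-156b), organ U2c «orbit uniformity + Hasse» — DEAL «M-156c» LEAD F0P6-plan (g12) 06:03:01Z; FILE 1∕2: the place-`w` model and the matrix algebra).
-/
import Summits.HodgeConjecture.HodgeConjecture.Theorems.K2LiuLineNoRankTwoCoinvariantsHerm   -- ★ p857907 (+ ★ p857826): partition trick, moment map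
import Literature.NumberTheory.Automorphic.UnitaryGroupSymplecticEmbedding                   -- ★ `UnitaryGroup.hermForm σ H`
import Mathlib.LinearAlgebra.Matrix.Determinant.Basic
import HarnessLib

/-!
# U2c, file 1∕2 «RANK-ONE LINE GRAMS»: a non-zero `(N_w, ψ_β)`-quasi-invariant functional forces `β` to be a Gram matrix of the line at `w`;
# the algebra of rank-one σ-hermitian Gram matrices `a · σ(u) ⊗ u` (norm classes, congruence, transport)

Track B ∕ K2-LIT, hLiu418 = stmt-HodgeConjecture-24832, socket #42F′ (U6 ED. 10 :767), ROAD I v3 organ U2c (SIGS-RoadI-v3 §2 row U2c, «U2c-fin» half;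
the CM-field half «U2c-glob» + the dock-ready «U2c-fin» in `locF` currency is file 2∕2 `K2LiuRankOneOrbitUniformity.lean`).  Namespace
`Summit.HodgeConjecture.HodgeConjecture.Cruxes.HLiu418.K2LiuRankOneLineGram`.  THEOREMS ONLY (no definition, no instance, no notation, no named fact,
no `sorry`); kernel lane `--supports stmt-HodgeConjecture-24832 --as helper`.  Written σ-EXPLICIT — the conjugation is a ring endomorphism `σ` and
«hermitian» is `(H.map σ)ᵀ = H`, the tree's idiom (★ `unitaryGroupOfForm σ H`, ★ `UnitaryGroup.hermForm σ H`, ★ `skewMatrices σ T`) — so that every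
head docks on ★ `conjLocal L c v` (local, `R = LocalRing L v = L ⊗ L⁺_v`) and on `IsCMField.complexConj L` (global) with NO `Star` instance.

THE MATHEMATICS ([KudlaRallis1994, §3: the `β`-th Fourier coefficient of a theta lift from `V′` is supported on the `β` REPRESENTED by `V′`];
[Rallis1984, §4]; [Scharlau1985HermitianForms, Ch. 10 §1: hermitian forms over a ring with involution]).  In the local model at a finite place `w` of U2a (the
Siegel unipotent radical acting on `𝒮(X)` by the second-degree multipliers `ψ(⟪b, G(x)⟫)` of the Gram map `G(x) = a · σ(v(x)) ⊗ v(x)` of a pair of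
vectors in the line `⟨a⟩`):
* §1 «A NON-ZERO `ψ_β`-FUNCTIONAL MEETS THE FIBRE» (the contrapositive of the twisted partition trick ★ p857826 ∕ ★ p857907): if some `ℓ ≠ 0`
  satisfies `ℓ (ρ z φ) = ψ_β z • ℓ φ`, then `G(x) = β` for some `x` — `β` IS A GRAM MATRIX OF THE LINE at `w` (`exists_forall_eq_of_functional_ne_zero`,
  `exists_momentMap_eq_of_functional_ne_zero` (submodule form), **`exists_lineGram_eq_of_functional_ne_zero`** (σ-hermitian line form)); and the
  σ-twin of U2a's head (`eq_zero_of_functional_rankTwo_conj`: σ-hermitian `β`, `det β ≠ 0` ⇒ `ℓ = 0`); the σ-hermitian matrices form an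
  `F`-submodule when `σ` fixes `F` (`exists_submodule_mem_iff_map_transpose_eq`).
* §2 RANK-ONE σ-HERMITIAN GRAMS (pure matrix algebra over a commutative ring `R` with `σ`): `a · σ(u) ⊗ u` is σ-hermitian
  (`map_transpose_smul_vecMulVec_conj`) of determinant `0` (`det_smul_vecMulVec_conj`); its hermitian form takes the values
  `⟪c, c′⟫ = a · σ(u·c) (u·c′)` — on the diagonal `a` TIMES A NORM (`hermForm_smul_vecMulVec_conj`); congruence `γ ↦ (σγ)ᵀ β γ` moves `u ↦ u γ`
  (`map_transpose_mul_smul_vecMulVec_mul`), so the congruence orbit of `diag(a, 0)` consists of the Grams of `⟨a⟩` at the rows of the congruence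
  matrices (`diagonal_eq_smul_vecMulVec_conj`, `map_transpose_mul_diagonal_mul`); TWO Gram presentations `a · σ(u) ⊗ u = b · σ(u′) ⊗ u′` with `u′`
  unimodular force `b = a · σ(t) t` (**`eq_mul_conj_mul_self_of_smul_vecMulVec_eq`** — the NORM CLASS `b ∕ a ∈ Nm` of a rank-one hermitian matrix
  relative to the line `⟨a⟩` is well defined), and conversely `b = a σ(e) e` transports `b · σ(u) ⊗ u = a · σ(e u) ⊗ (e u)`
  (`smul_vecMulVec_conj_eq_of_eq_mul_conj_mul_self`); over a field every non-zero σ-hermitian `β ∈ M₂` with `det β = 0` is `β_ii · σ(u) ⊗ u` with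
  `u_i = 1` (`exists_eq_smul_vecMulVec_conj_of_det_eq_zero`: «rank one = the class of `diag(b, 0)`»).

HONEST LABEL: HC_CM is proved only modulo the 7 printed citations (2 remaining named inputs: hLiu418 = stmt-HodgeConjecture-24832, h413 =
stmt-HodgeConjecture-24833) until rung 0 closes; this file is one half of organ U2c of Road I for #42F′ and moves no counter.

## References
* [KudlaRallis1994] S. S. Kudla, S. Rallis, *A regularized Siegel–Weil formula: the first term identity*, Ann. of Math. 140 (1994) 1–80, §3.
* [Rallis1984] S. Rallis, *On the Howe duality conjecture*, Compositio Math. 51 (1984) 333–399, §4.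
* [Kudla1986] S. S. Kudla, *On the local theta-correspondence*, Invent. Math. 83 (1986) 229–255, proof of Thm. 2.8.
* [Scharlau1985HermitianForms] W. Scharlau, *Quadratic and Hermitian Forms*, Grundlehren 270 (1985), Ch. 10 §1 (hermitian forms over rings with involution).
-/

set_option autoImplicit false
set_option linter.dupNamespace false

noncomputable section

open Set
open scoped Matrix
open Literature.NumberTheory.Automorphic Literature.RepresentationTheory
open Literature.NumberTheory.Automorphic.UnitaryGroup
open Summit.HodgeConjecture.HodgeConjecture.Cruxes.HLiu418.K2LiuLineNoRankTwoCoinvariants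
open Summit.HodgeConjecture.HodgeConjecture.Cruxes.HLiu418.K2LiuLineNoRankTwoCoinvariantsHerm

namespace Summit.HodgeConjecture.HodgeConjecture.Cruxes.HLiu418.K2LiuRankOneLineGram

/-! ## §1 A non-zero `ψ_β`-quasi-invariant functional meets the fibre `{G = β}` -/

section Fibre

variable {X : Type*} [TopologicalSpace X] {Z : Type*} [Group Z]
  (ρ : Representation ℂ Z ↥(SchwartzBruhat X)) (u : Z → X → ℂ) (hu : ∀ z, IsLocallyConstant (u z))
  (hρ : ∀ (z : Z) (φ : ↥(SchwartzBruhat X)), ((ρ z φ : ↥(SchwartzBruhat X)) : X → ℂ) = u z * φ)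
  (χ : Z →* ℂˣ)

include hu hρ in
/-- **a non-zero `(Z, χ)`-quasi-invariant functional forces a point FIXED by every multiplier** (`u z x = χ z` for all `z`): the contrapositive of the
twisted partition trick ★ `functional_eq_zero_of_forall_exists_ne`. [cite: Rallis1984, §4] [cite: KudlaRallis1994, §3] -/
theorem exists_forall_eq_of_functional_ne_zero {M : Type*} [AddCommGroup M] [Module ℂ M] (Λ : ↥(SchwartzBruhat X) →ₗ[ℂ] M)
    (hΛ : ∀ (z : Z) (φ : ↥(SchwartzBruhat X)), Λ (ρ z φ) = ((χ z : ℂˣ) : ℂ) • Λ φ) (hΛ0 : Λ ≠ 0) :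
    ∃ x : X, ∀ z : Z, u z x = ((χ z : ℂˣ) : ℂ) := by
  by_contra h
  push Not at h
  exact hΛ0 (functional_eq_zero_of_forall_exists_ne ρ u hu hρ χ h Λ hΛ)

end Fibre

section MomentMap

variable {F : Type*} [Field F] {B : Type*} [AddCommGroup B] [Module F B]
  (π : B →ₗ[F] B →ₗ[F] F) (S : Submodule F B) (hπ : ∀ H ∈ S, H ≠ 0 → ∃ s ∈ S, π s H ≠ 0)
  (ψ : AddChar F Circle) (hψ : ∃ a : F, ((ψ a : Circle) : ℂ) ≠ 1)
  {X : Type*} [TopologicalSpace X] {Z : Type*} [Group Z]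
  (ρ : Representation ℂ Z ↥(SchwartzBruhat X)) (b : Z → B) (hbS : ∀ s ∈ S, ∃ z, b z = s) (G : X → B) (β : B)
  (hu : ∀ z, IsLocallyConstant fun x => ((ψ (π (b z) (G x)) : Circle) : ℂ))
  (hρ : ∀ (z : Z) (φ : ↥(SchwartzBruhat X)),
    ((ρ z φ : ↥(SchwartzBruhat X)) : X → ℂ) = (fun x => ((ψ (π (b z) (G x)) : Circle) : ℂ)) * φ)
  (χ : Z →* ℂˣ) (hχ : ∀ z, ((χ z : ℂˣ) : ℂ) = ((ψ (π (b z) β) : Circle) : ℂ))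

include hπ hψ hbS hu hρ hχ in
/-- **«THE COEFFICIENT IS SUPPORTED ON REPRESENTED `β`»** (submodule form): in the moment-map model of ★ `twistedCoinv_ker_eq_top_of_momentMap_ne_submodule`
(parameters filling an `F`-submodule `S` on which `π` is non-degenerate, `G x − β ∈ S`), a NON-ZERO `ψ_β`-quasi-invariant functional exists only if
`G x = β` for some `x`. [cite: KudlaRallis1994, §3] [cite: Rallis1984, §4] -/
theorem exists_momentMap_eq_of_functional_ne_zero {M : Type*} [AddCommGroup M] [Module ℂ M] (hGβ : ∀ x, G x - β ∈ S)
    (Λ : ↥(SchwartzBruhat X) →ₗ[ℂ] M) (hΛ : ∀ (z : Z) (φ : ↥(SchwartzBruhat X)), Λ (ρ z φ) = ((χ z : ℂˣ) : ℂ) • Λ φ) (hΛ0 : Λ ≠ 0) :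
    ∃ x : X, G x = β := by
  by_contra h
  push Not at h
  exact hΛ0 (eq_zero_of_twistedQuasiInvariant_of_momentMap_ne_submodule π S hπ ψ hψ ρ b hbS G β hu hρ χ hχ hGβ h Λ hΛ)

end MomentMap

/-! ## §2 Rank-one σ-hermitian Gram matrices `a · σ(u) ⊗ u` over a commutative ring with a conjugation `σ` -/

section Gram

variable {R : Type*} [CommRing R] (σ : R →+* R)

/-- **`a · σ(u) ⊗ u` is σ-HERMITIAN** (`σ` an involution fixing `a`): `(σ G)ᵀ = G`. [cite: Scharlau1985HermitianForms, Ch. 10 §1] -/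
theorem map_transpose_smul_vecMulVec_conj (hσ : ∀ x, σ (σ x) = x) {a : R} (ha : σ a = a) {ι : Type*} (u : ι → R) :
    ((a • Matrix.vecMulVec (⇑σ ∘ u) u).map σ)ᵀ = a • Matrix.vecMulVec (⇑σ ∘ u) u := by
  ext i j
  simp only [Matrix.transpose_apply, Matrix.map_apply, Matrix.smul_apply, Matrix.vecMulVec_apply, Function.comp_apply, smul_eq_mul,
    map_mul, hσ, ha]
  ring

/-- **`det (a · σ(u) ⊗ u) = 0`** for a pair `u : Fin 2 → R`: a Gram matrix of a pair of vectors in a LINE has rank `≤ 1` (★ `det_smul_vecMulVec_fin_two`).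
[cite: Rallis1984, §4] -/
theorem det_smul_vecMulVec_conj (a : R) (u : Fin 2 → R) : (a • Matrix.vecMulVec (⇑σ ∘ u) u).det = 0 :=
  det_smul_vecMulVec_fin_two a (⇑σ ∘ u) u

/-- **the hermitian form of `a · σ(u) ⊗ u` takes the values `⟪c, c′⟫ = a · σ(u·c) · (u·c′)`** — on the diagonal, `a` TIMES A NORM `σ(t) t`.
[cite: Scharlau1985HermitianForms, Ch. 10 §1] -/
theorem hermForm_smul_vecMulVec_conj {ι : Type*} [Fintype ι] (a : R) (u c c' : ι → R) :
    hermForm σ (a • Matrix.vecMulVec (⇑σ ∘ u) u) c c' = a * (σ (u ⬝ᵥ c) * (u ⬝ᵥ c')) := by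
  simp only [hermForm, dotProduct, Matrix.mulVec, Matrix.smul_apply, Matrix.vecMulVec_apply, Function.comp_apply, smul_eq_mul, map_sum,
    map_mul, Finset.mul_sum, Finset.sum_mul]
  rw [Finset.sum_comm]
  refine Finset.sum_congr rfl fun i _ => Finset.sum_congr rfl fun j _ => ?_
  ring

/-- **congruence moves the vector**: `(σγ)ᵀ (a · σ(u) ⊗ u) γ = a · σ(uγ) ⊗ (uγ)`. [cite: Scharlau1985HermitianForms, Ch. 10 §1] -/
theorem map_transpose_mul_smul_vecMulVec_mul {ι κ : Type*} [Fintype ι] (a : R) (u : ι → R) (γ : Matrix ι κ R) :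
    (γ.map σ)ᵀ * (a • Matrix.vecMulVec (⇑σ ∘ u) u) * γ = a • Matrix.vecMulVec (⇑σ ∘ (u ᵥ* γ)) (u ᵥ* γ) := by
  rw [Matrix.mul_smul, Matrix.smul_mul, Matrix.mul_vecMulVec, Matrix.vecMulVec_mul, Matrix.mulVec_transpose]
  congr 2
  funext i
  simp only [Function.comp_apply]
  exact (RingHom.map_vecMul σ γ u i).symm

/-- `diag(a, 0) = a · σ(e₀) ⊗ e₀`: the diagonal class representative is the Gram of the line `⟨a⟩` at the first basis vector. [folklore] -/
theorem diagonal_eq_smul_vecMulVec_conj (a : R) :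
    Matrix.diagonal ![a, 0] = a • Matrix.vecMulVec (⇑σ ∘ Pi.single (0 : Fin 2) (1 : R)) (Pi.single (0 : Fin 2) (1 : R)) := by
  ext i j
  fin_cases i <;> fin_cases j <;> simp [Matrix.vecMulVec_apply]

/-- **the congruence orbit of `diag(a, 0)` consists of Grams of the line `⟨a⟩` at ROWS of the congruence matrix**: `(σγ)ᵀ diag(a,0) γ = a · σ(γ₀) ⊗ γ₀`.
[cite: Scharlau1985HermitianForms, Ch. 10 §1] -/
theorem map_transpose_mul_diagonal_mul {κ : Type*} (a : R) (γ : Matrix (Fin 2) κ R) :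
    (γ.map σ)ᵀ * Matrix.diagonal ![a, 0] * γ = a • Matrix.vecMulVec (⇑σ ∘ γ 0) (γ 0) := by
  rw [diagonal_eq_smul_vecMulVec_conj σ a, map_transpose_mul_smul_vecMulVec_mul, Matrix.single_one_vecMul]
  rfl

/-- **THE NORM CLASS OF A RANK-ONE HERMITIAN MATRIX IS WELL DEFINED**: two Gram presentations `a · σ(u) ⊗ u = b · σ(u′) ⊗ u′` with `u′` UNIMODULAR
(`u′ · c = 1`) force `b = a · σ(t) · t` with `t = u · c` — `b ∕ a` is a norm. [cite: Scharlau1985HermitianForms, Ch. 10 §1] [cite: KudlaRallis1994, §3] -/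
theorem eq_mul_conj_mul_self_of_smul_vecMulVec_eq {ι : Type*} [Fintype ι] {a b : R} {u u' : ι → R}
    (h : a • Matrix.vecMulVec (⇑σ ∘ u) u = b • Matrix.vecMulVec (⇑σ ∘ u') u') (c : ι → R) (hc : u' ⬝ᵥ c = 1) :
    b = a * (σ (u ⬝ᵥ c) * (u ⬝ᵥ c)) := by
  have := congrArg (fun H => hermForm σ H c c) h
  rw [hermForm_smul_vecMulVec_conj, hermForm_smul_vecMulVec_conj, hc, map_one, mul_one, mul_one] at this
  exact this.symm

/-- **norms transport Gram presentations**: `b = a · σ(e) e ⇒ b · σ(u) ⊗ u = a · σ(e u) ⊗ (e u)`. [cite: Scharlau1985HermitianForms, Ch. 10 §1] -/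
theorem smul_vecMulVec_conj_eq_of_eq_mul_conj_mul_self {ι : Type*} {a b e : R} (h : b = a * (σ e * e)) (u : ι → R) :
    b • Matrix.vecMulVec (⇑σ ∘ u) u = a • Matrix.vecMulVec (⇑σ ∘ (e • u)) (e • u) := by
  ext i j
  simp only [Matrix.smul_apply, Matrix.vecMulVec_apply, Function.comp_apply, Pi.smul_apply, smul_eq_mul, map_mul, h]
  ring

end Gram

section RankOne

variable {K : Type*} [Field K] (σ : K →+* K) (hσ : ∀ x, σ (σ x) = x)

include hσ in
/-- **«RANK ONE = THE CLASS OF `diag(b, 0)`»**: over a field with involution `σ`, a NON-ZERO σ-hermitian `β ∈ M₂` with `det β = 0` is `β_ii · σ(u) ⊗ u` for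
a diagonal entry `β_ii ≠ 0` (fixed by `σ`) and a vector `u` with `u_i = 1` — the Gram matrix of the line `⟨β_ii⟩` at a unimodular pair.
[cite: Scharlau1985HermitianForms, Ch. 10 §1] -/
theorem exists_eq_smul_vecMulVec_conj_of_det_eq_zero (β : Matrix (Fin 2) (Fin 2) K) (hβh : (β.map σ)ᵀ = β) (hdet : β.det = 0)
    (hβ0 : β ≠ 0) :
    ∃ (i : Fin 2) (u : Fin 2 → K), u i = 1 ∧ β i i ≠ 0 ∧ σ (β i i) = β i i ∧ β = β i i • Matrix.vecMulVec (⇑σ ∘ u) u := by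
  have hh : ∀ i j, σ (β j i) = β i j := fun i j => by
    have := congrFun (congrFun hβh i) j
    simpa only [Matrix.transpose_apply, Matrix.map_apply] using this
  have hd : β 0 0 * β 1 1 - β 0 1 * β 1 0 = 0 := by rwa [Matrix.det_fin_two] at hdet
  have hσinj : ∀ x : K, σ x = 0 → x = 0 := fun x hx => by rw [← hσ x, hx, map_zero]
  have hdiag : β 0 0 ≠ 0 ∨ β 1 1 ≠ 0 := by
    by_contra h
    push Not at h
    obtain ⟨h0, h1⟩ := h
    have h01 : β 0 1 = 0 := by
      have hprod : β 0 1 * σ (β 0 1) = 0 := by rw [hh 1 0]; linear_combination (-1 : K) * hd + β 1 1 * h0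
      rcases mul_eq_zero.1 hprod with h' | h'
      · exact h'
      · exact hσinj _ h'
    have h10 : β 1 0 = 0 := by rw [← hh 1 0, h01, map_zero]
    exact hβ0 (by ext i j; fin_cases i <;> fin_cases j <;> simp [h0, h1, h01, h10])
  rcases hdiag with h0 | h1
  · refine ⟨0, fun j => β 0 j / β 0 0, div_self h0, h0, hh 0 0, ?_⟩
    ext j k
    fin_cases j <;> fin_cases k <;>
      simp only [Matrix.smul_apply, Matrix.vecMulVec_apply, Function.comp_apply, smul_eq_mul, map_div₀, hh, Fin.zero_eta, Fin.isValue,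
        Fin.mk_one] <;> field_simp
    · linear_combination hd
  · refine ⟨1, fun j => β 1 j / β 1 1, div_self h1, h1, hh 1 1, ?_⟩
    ext j k
    fin_cases j <;> fin_cases k <;>
      simp only [Matrix.smul_apply, Matrix.vecMulVec_apply, Function.comp_apply, smul_eq_mul, map_div₀, hh, Fin.zero_eta, Fin.isValue,
        Fin.mk_one] <;> field_simp
    · linear_combination hd

end RankOne

/-! ## §1′ The line form of §1 (σ-hermitian carrier) and the σ-twin of U2a's head -/

section LineFibre

variable {R : Type*} [CommRing R] {F : Type*} [Field F] [Algebra F R]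
  (σ : R →+* R) (hσ : ∀ x, σ (σ x) = x) (hσF : ∀ c : F, σ (algebraMap F R c) = algebraMap F R c)

include hσF in
/-- the σ-hermitian matrices form an `F`-submodule of `M_ι(R)` (`σ` fixes the scalar field `F`). [folklore] -/
theorem exists_submodule_mem_iff_map_transpose_eq (ι : Type*) :
    ∃ S : Submodule F (Matrix ι ι R), ∀ H : Matrix ι ι R, H ∈ S ↔ (H.map σ)ᵀ = H := by
  refine ⟨{ carrier := {H | (H.map σ)ᵀ = H}
            add_mem' := fun {A B} hA hB => ?_
            zero_mem' := ?_
            smul_mem' := fun c H hH => ?_ }, fun H => Iff.rfl⟩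
  · change (A.map σ)ᵀ = A at hA
    change (B.map σ)ᵀ = B at hB
    change ((A + B).map σ)ᵀ = A + B
    ext i j
    have hA' := congrFun (congrFun hA i) j
    have hB' := congrFun (congrFun hB i) j
    simp only [Matrix.transpose_apply, Matrix.map_apply, Matrix.add_apply, map_add] at hA' hB' ⊢
    rw [hA', hB']
  · change ((0 : Matrix ι ι R).map σ)ᵀ = 0
    ext i j
    simp only [Matrix.transpose_apply, Matrix.map_apply, Matrix.zero_apply, map_zero]
  · change (H.map σ)ᵀ = H at hH
    change ((c • H).map σ)ᵀ = c • H
    ext i j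
    have h := congrFun (congrFun hH i) j
    simp only [Matrix.transpose_apply, Matrix.map_apply, Matrix.smul_apply] at h ⊢
    rw [Algebra.smul_def, map_mul, hσF, h, Algebra.smul_def]

variable (π : Matrix (Fin 2) (Fin 2) R →ₗ[F] Matrix (Fin 2) (Fin 2) R →ₗ[F] F)
  (hπ : ∀ H : Matrix (Fin 2) (Fin 2) R, (H.map σ)ᵀ = H → H ≠ 0 → ∃ s : Matrix (Fin 2) (Fin 2) R, (s.map σ)ᵀ = s ∧ π s H ≠ 0)
  (ψ : AddChar F Circle) (hψ : ∃ a : F, ((ψ a : Circle) : ℂ) ≠ 1)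
  {X : Type*} [TopologicalSpace X] {Z : Type*} [Group Z] (ρ : Representation ℂ Z ↥(SchwartzBruhat X))
  (b : Z → Matrix (Fin 2) (Fin 2) R) (hb : ∀ s : Matrix (Fin 2) (Fin 2) R, (s.map σ)ᵀ = s → ∃ z, b z = s)
  (a : R) (ha : σ a = a) (v : X → Fin 2 → R) (β : Matrix (Fin 2) (Fin 2) R)
  (hu : ∀ z, IsLocallyConstant fun x => ((ψ (π (b z) (a • Matrix.vecMulVec (⇑σ ∘ v x) (v x))) : Circle) : ℂ))
  (hρ : ∀ (z : Z) (φ : ↥(SchwartzBruhat X)),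
    ((ρ z φ : ↥(SchwartzBruhat X)) : X → ℂ) = (fun x => ((ψ (π (b z) (a • Matrix.vecMulVec (⇑σ ∘ v x) (v x))) : Circle) : ℂ)) * φ)
  (χ : Z →* ℂˣ) (hχ : ∀ z, ((χ z : ℂˣ) : ℂ) = ((ψ (π (b z) β) : Circle) : ℂ))

include hσ hσF hπ hψ hb ha hu hρ hχ in
/-- **«U2c-fin», MODEL FORM: a non-zero `(N_w, ψ_β)`-quasi-invariant functional makes `β` a GRAM MATRIX OF THE LINE at `w`.**  In the Schrödinger-type
model of U2a read σ-explicitly (the Siegel unipotent radical, through `b : Z → M₂(R)` onto the σ-hermitian matrices, acts by the multipliers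
`x ↦ ψ(⟪b z, a · σ(v x) ⊗ v x⟫)`; `π` detects non-zero σ-hermitian `H` by σ-hermitian parameters; `σ` an involution fixing `F` and `a`): if `β` is
σ-hermitian and some `ℓ ≠ 0` satisfies `ℓ (ρ z φ) = ψ_β z • ℓ φ`, then `a · σ(v x) ⊗ v x = β` for some `x`.
[cite: KudlaRallis1994, §3] [cite: Rallis1984, §4] -/
theorem exists_lineGram_eq_of_functional_ne_zero {M : Type*} [AddCommGroup M] [Module ℂ M] :
    (β.map σ)ᵀ = β → ∀ Λ : ↥(SchwartzBruhat X) →ₗ[ℂ] M,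
      (∀ (z : Z) (φ : ↥(SchwartzBruhat X)), Λ (ρ z φ) = ((χ z : ℂˣ) : ℂ) • Λ φ) → Λ ≠ 0 →
        ∃ x : X, a • Matrix.vecMulVec (⇑σ ∘ v x) (v x) = β := by
  intro hβh Λ hΛ hΛ0
  obtain ⟨S, hS⟩ := exists_submodule_mem_iff_map_transpose_eq σ hσF (F := F) (Fin 2)
  refine exists_momentMap_eq_of_functional_ne_zero π S (fun H hH hH0 => ?_) ψ hψ ρ b (fun s hs => hb s ((hS s).1 hs))
    (fun x => a • Matrix.vecMulVec (⇑σ ∘ v x) (v x)) β hu hρ χ hχ (fun x => ?_) Λ hΛ hΛ0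
  · obtain ⟨s, hs, hsH⟩ := hπ H ((hS H).1 hH) hH0
    exact ⟨s, (hS s).2 hs, hsH⟩
  · refine S.sub_mem ((hS _).2 (map_transpose_smul_vecMulVec_conj σ hσ ha (v x))) ((hS β).2 hβh)

include hσ hσF hπ hψ hb ha hu hρ hχ in
/-- **the σ-twin of U2a's head ★ `eq_zero_of_twistedQuasiInvariant_rankTwo`**: for σ-hermitian `β` with `det β ≠ 0` every `ψ_β`-quasi-invariant
functional vanishes (no `Star` instance needed at the dock). [cite: Kudla1986, proof of Thm. 2.8] [cite: Rallis1984, §4] -/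
theorem eq_zero_of_functional_rankTwo_conj {M : Type*} [AddCommGroup M] [Module ℂ M] :
    (β.map σ)ᵀ = β → β.det ≠ 0 → ∀ Λ : ↥(SchwartzBruhat X) →ₗ[ℂ] M,
      (∀ (z : Z) (φ : ↥(SchwartzBruhat X)), Λ (ρ z φ) = ((χ z : ℂˣ) : ℂ) • Λ φ) → Λ = 0 := by
  intro hβh hdet Λ hΛ
  by_contra hΛ0
  obtain ⟨x, hx⟩ := exists_lineGram_eq_of_functional_ne_zero σ hσ hσF π hπ ψ hψ ρ b hb a ha v β hu hρ χ hχ hβh Λ hΛ hΛ0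
  exact hdet (by rw [← hx]; exact det_smul_vecMulVec_conj σ a (v x))

end LineFibre

end Summit.HodgeConjecture.HodgeConjecture.Cruxes.HLiu418.K2LiuRankOneLineGram

end
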